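import Literature.Computability.AlgebraicComplexity.BI17TensorFiniteStabilizerLocusProofs
import HarnessLib

/-!
# Generic finiteness of the `SL_m³`-stabilizer on `⊗³ℂ^m` for EVERY `m ≥ 3`: an explicit witness
# family, and BI 2017 Prop. 4.10 from Popov's 1970 criterion alone

Bürgisser–Ikenmeyer, *Fundamental invariants of orbit closures* (J. Algebra **477** (2017) =
arXiv:1511.02927) [BurgisserIkenmeyer2017], proof of Prop. 4.10 (TeX L1927–1937): Popov's
stability criterion for the semisimple group `SL_m³` needs that the (reduced) stabilizer of almost
all `w ∈ ⊗³ℂ^m` is FINITE; the print takes this from Thm. 4.2 / A. M. Popov's classification of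
generic stabilizers (`m ≥ 4`). This file proves the generic finiteness DIRECTLY, for every `m ≥ 3`,
so that `BI2017_prop_4_10` hangs on the cite-fact `Popov1970_genericClosedOrbit_tensor` alone
(`BI2017_prop_4_10_of_popov70`); A. M. Popov's 1987 theorem (`BI2017_popov_trivialStabilizer`)
is no longer an input of this edge.

* `isZariskiGenericTensor_hasTrivialSL3LieStabilizer_of_exists` — certificate-free form of the
  genericity step of `BI17TensorFiniteStabilizerLocusProofs.lean`: ONE tensor `w₀` with zero
  traceless infinitesimal stabilizer makes the property Zariski-generic (a maximal minor of the
  generic `sl3LieMatrix` that does not vanish at `w₀`; upper semicontinuity of the rank).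
* **`hasTrivialSL3LieStabilizer_bandWitness`** — the explicit tensor
  `w_m = ∑_a (e_a ⊗ e_a ⊗ e_a + e_a ⊗ e_a ⊗ e_{a+1} + e_{a+1} ⊗ e_a ⊗ e_a) ∈ ⊗³ℂ^m`
  (indices mod `m`, `bandWitness`) has ZERO traceless infinitesimal stabilizer for every `m ≥ 4`.
  Proof: the infinitesimal action `((X ⊗ 1 ⊗ 1 + 1 ⊗ Y ⊗ 1 + 1 ⊗ 1 ⊗ Z)·w_m)_{abc}` is the
  nine-term expression `lieAction_bandWitness_apply`; its vanishing at the index patterns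
  `(a,b,b+1)`, `(a,b,a+1)`, `(b+1,b,c)` confines `X`, `Y`, `Z` to three cyclic bands each, the
  patterns `(b,b+1,b)`, `(b,b,b+3)`, `(b+3,b,b)`, `(b+2,b,b+1)`, `(b+1,b,b+2)`, `(b+2,b,b)`,
  `(b,b,b+2)` kill the off-diagonal bands, `(b,b,b)`, `(b,b,b+1)`, `(b+1,b,b)` make the three
  diagonals constant, and `tr X = tr Y = tr Z = 0` kills the constants (the full `𝔤𝔩³`-kernel is
  exactly the scalar 2-torus). Only `1, 2, 3 ≠ 0 (mod m)` is used, i.e. `m ≥ 4`.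
* **`isZariskiGenericTensor_finite_slStabilizer`** — for every `m ≥ 3`, almost all `w ∈ ⊗³ℂ^m`
  have a finite `SL_m³`-stabilizer (`m = 3`: the kernel certificate
  `isZariskiGenericTensor_finite_slStabilizer_three`; `m ≥ 4`: the witness family and the
  Lie-algebra criterion `finite_slStabilizer_of_hasTrivialSL3LieStabilizer`).
* **`BI2017_prop_4_10_of_popov70`** — `BI2017_prop_4_10 ⇐ {Popov1970_genericClosedOrbit_tensor}`
  (`m ≤ 1` trivial, `m = 2` the tree's `BI2017_prop_4_10_two`); and
  `BI2017_cor_5_12_of_thm_4_2_of_popov70` — `BI2017_cor_5_12 ⇐ {BI2017_thm_4_2, Popov 1970}`.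
  Edges BY NAME, not strikes.

One definition with body (`bandWitness`, the witness family), no named facts, no instances. Honest
framing: a classical genericity statement with an explicit witness; typed-literature infrastructure
for the cell `val-lit` (LADDER-VALIANT V3, a known-results layer); VP ≠ VNP is NOT proved and
nothing here bears on it.

## References

* [BurgisserIkenmeyer2017] P. Bürgisser, C. Ikenmeyer, *Fundamental invariants of orbit closures*,
  J. Algebra 477 (2017) 390–434 = arXiv:1511.02927, §4.1 eq. (4.1), Thm. 4.2, Prop. 4.10 (proof,
  L1927–1937), Cor. 5.12.
* [SpringerLAG1998] T. A. Springer, *Linear Algebraic Groups*, 2nd ed., Thm 4.3.3 (iii).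
-/

set_option Elab.async false

noncomputable section

namespace Literature.Computability.AlgebraicComplexity

open MvPolynomial Matrix

/-- The three elements of `Fin 3`. [folklore] -/
private theorem fin3_eq' (s : Fin 3) : s = 0 ∨ s = 1 ∨ s = 2 := by
  revert s; decide

/-! ### Genericity from one point with zero traceless infinitesimal stabilizer -/

section Semicontinuity

variable {ι : Type*} [Fintype ι] [DecidableEq ι]

/-- A zero traceless infinitesimal stabilizer is injectivity of `sl3LieMatrix w` (converse of
`hasTrivialSL3LieStabilizer_of_mulVec_injective`).
[cite: BurgisserIkenmeyer2017, §4.1 and Prop. 4.10 (proof)] -/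
theorem mulVec_injective_of_hasTrivialSL3LieStabilizer {K : Type*} [CommRing K]
    (w : ι → ι → ι → K) (h : HasTrivialSL3LieStabilizer w) :
    Function.Injective (sl3LieMatrix w).mulVec := by
  intro v v' hvv'
  rw [← sub_eq_zero]
  set d : Fin 3 × ι × ι → K := v - v' with hd
  have hMd : (sl3LieMatrix w).mulVec d = 0 := by
    rw [hd, Matrix.mulVec_sub, hvv', sub_self]
  obtain ⟨h0, h1, h2⟩ := h (Matrix.of fun i j => d (0, i, j)) (Matrix.of fun i j => d (1, i, j))
    (Matrix.of fun i j => d (2, i, j))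
    (by rw [← sl3LieMatrix_mulVec_inr w d 0, hMd, Pi.zero_apply])
    (by rw [← sl3LieMatrix_mulVec_inr w d 1, hMd, Pi.zero_apply])
    (by rw [← sl3LieMatrix_mulVec_inr w d 2, hMd, Pi.zero_apply])
    (by
      funext a b c
      rw [← sl3LieMatrix_mulVec_inl w d a b c, hMd]
      rfl)
  funext p
  obtain ⟨s, i, j⟩ := p
  rcases fin3_eq' s with rfl | rfl | rfl
  · exact congr_fun (congr_fun h0 i) j
  · exact congr_fun (congr_fun h1 i) j
  · exact congr_fun (congr_fun h2 i) j

/-- A matrix over `ℂ` with injective `mulVec` (independent columns) has a non-singular square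
submatrix on some rows. [folklore] -/
private theorem exists_submatrix_det_ne_zero'' {ρ κ : Type*} [Fintype ρ] [Fintype κ] [DecidableEq κ]
    (A : Matrix ρ κ ℂ) (hA : Function.Injective A.mulVec) :
    ∃ e : κ → ρ, (A.submatrix e id).det ≠ 0 := by
  classical
  have hrank : A.rank = Fintype.card κ := by
    have hinj : Function.Injective A.mulVecLin := fun x y hxy => hA hxy
    rw [Matrix.rank, LinearMap.finrank_range_of_inj hinj, Module.finrank_fintype_fun_eq_card]
  obtain ⟨κ', a, ha, hspan, hli⟩ := exists_linearIndependent' (K := ℂ) A.row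
  haveI : Finite κ' := hli.finite
  letI : Fintype κ' := Fintype.ofFinite κ'
  have hcard : Fintype.card κ' = Fintype.card κ := by
    rw [linearIndependent_iff_card_eq_finrank_span.mp hli, Set.finrank, hspan,
      ← Matrix.rank_eq_finrank_span_row, hrank]
  obtain ⟨e⟩ : Nonempty (κ ≃ κ') := Fintype.card_eq.mp hcard.symm
  refine ⟨a ∘ e, ?_⟩
  have hli' : LinearIndependent ℂ (A.submatrix (a ∘ e) id).row := by
    have : (A.submatrix (a ∘ e) id).row = (A.row ∘ a) ∘ e := by
      funext i; rfl
    rw [this]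
    exact hli.comp e e.injective
  have hU := Matrix.linearIndependent_rows_iff_isUnit.mp hli'
  rw [Matrix.isUnit_iff_isUnit_det] at hU
  exact hU.ne_zero

/-- **Upper semicontinuity: ONE tensor with zero traceless infinitesimal stabilizer makes the
property Zariski-generic** — the test polynomial is a maximal minor of the generic `sl3LieMatrix`
(entries: coordinates of `w`, `0`, `1`) chosen non-singular at `w₀`; where it does not vanish,
`sl3LieMatrix w` is injective.
[cite: BurgisserIkenmeyer2017, §4.1 ("almost all") and Prop. 4.10 (proof)] -/
theorem isZariskiGenericTensor_hasTrivialSL3LieStabilizer_of_exists (w₀ : ι → ι → ι → ℂ)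
    (h₀ : HasTrivialSL3LieStabilizer w₀) :
    IsZariskiGenericTensor (fun w : ι → ι → ι → ℂ => HasTrivialSL3LieStabilizer w) := by
  classical
  obtain ⟨e, he⟩ := exists_submatrix_det_ne_zero'' _
    (mulVec_injective_of_hasTrivialSL3LieStabilizer w₀ h₀)
  let Mgen : Matrix ((ι × ι × ι) ⊕ Fin 3) (Fin 3 × ι × ι) (MvPolynomial (ι × ι × ι) ℂ) :=
    sl3LieMatrix fun a b c => X (a, b, c)
  let F : MvPolynomial (ι × ι × ι) ℂ := (Mgen.submatrix e id).det
  have hevalM : ∀ w : ι → ι → ι → ℂ, Mgen.map (aeval (tensorPt w)) = sl3LieMatrix w := by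
    intro w
    show (sl3LieMatrix fun a b c => (X (a, b, c) : MvPolynomial (ι × ι × ι) ℂ)).map
      (aeval (tensorPt w)) = sl3LieMatrix w
    rw [sl3LieMatrix_map]
    congr 1
    funext a b c
    rw [aeval_X]
    rfl
  have hevalF : ∀ w : ι → ι → ι → ℂ,
      aeval (tensorPt w) F = ((sl3LieMatrix w).submatrix e id).det := by
    intro w
    show aeval (tensorPt w) (Mgen.submatrix e id).det = _
    rw [AlgHom.map_det, AlgHom.mapMatrix_apply, ← Matrix.submatrix_map, hevalM]
  refine ⟨F, ?_, fun w hw => ?_⟩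
  · intro hF0
    have h1 := hevalF w₀
    rw [hF0, map_zero] at h1
    exact he h1.symm
  · rw [hevalF] at hw
    apply hasTrivialSL3LieStabilizer_of_mulVec_injective
    intro v v' hvv'
    rw [← sub_eq_zero]
    apply Matrix.eq_zero_of_mulVec_eq_zero hw
    rw [Matrix.mulVec_sub]
    have h1 : ((sl3LieMatrix w).submatrix e id).mulVec v =
        ((sl3LieMatrix w).submatrix e id).mulVec v' := by
      funext i
      have := congr_fun hvv' (e i)
      simpa [Matrix.mulVec, dotProduct, Matrix.submatrix_apply] using this
    rw [h1, sub_self]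

/-- Hence ONE tensor with zero traceless infinitesimal stabilizer gives: **almost all `w ∈ ⊗³ℂ^ι`
have a finite `SL³`-stabilizer.** [cite: BurgisserIkenmeyer2017, Prop. 4.10 (proof)] -/
theorem isZariskiGenericTensor_finite_slStabilizer_of_exists (w₀ : ι → ι → ι → ℂ)
    (h₀ : HasTrivialSL3LieStabilizer w₀) :
    IsZariskiGenericTensor fun w : ι → ι → ι → ℂ =>
      {g : Matrix.SpecialLinearGroup ι ℂ × Matrix.SpecialLinearGroup ι ℂ ×
          Matrix.SpecialLinearGroup ι ℂ |
        actTensor (g.1 : Matrix ι ι ℂ) (g.2.1 : Matrix ι ι ℂ) (g.2.2 : Matrix ι ι ℂ) w = w}.Finite :=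
  (isZariskiGenericTensor_hasTrivialSL3LieStabilizer_of_exists w₀ h₀).mono
    fun w hw => finite_slStabilizer_of_hasTrivialSL3LieStabilizer w hw

end Semicontinuity

/-! ### The witness family `w_m`, `m = n + 4` -/

section Witness

variable (n : ℕ)

/-- **The witness tensor** `w_m = ∑_a (e_a ⊗ e_a ⊗ e_a + e_a ⊗ e_a ⊗ e_{a+1} + e_{a+1} ⊗ e_a ⊗ e_a)
∈ ⊗³ℂ^m`, `m = n + 4`, indices mod `m` (coordinates: `w_{abc} = [a=b=c] + [a=b, c=b+1] +
[a=b+1, c=b]`): an explicit tensor whose `SL_m³`-stabilizer is finite (its traceless infinitesimal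
stabilizer is zero, `hasTrivialSL3LieStabilizer_bandWitness`), witnessing the generic finiteness
used in the proof of BI 2017 Prop. 4.10. [cite: BurgisserIkenmeyer2017, Prop. 4.10 (proof)] -/
def bandWitness : Fin (n + 4) → Fin (n + 4) → Fin (n + 4) → ℂ := fun a b c =>
  (if a = b ∧ b = c then 1 else 0) + (if a = b ∧ c = b + 1 then 1 else 0) +
    (if a = b + 1 ∧ c = b then 1 else 0)

/-- `(X ⊗ 1 ⊗ 1)·w_m` in coordinates. [folklore] -/
private theorem actTensor_fst_bandWitness (X : Matrix (Fin (n + 4)) (Fin (n + 4)) ℂ)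
    (a b c : Fin (n + 4)) :
    actTensor X (1 : Matrix (Fin (n + 4)) (Fin (n + 4)) ℂ) (1 : Matrix (Fin (n + 4)) (Fin (n + 4)) ℂ)
        (bandWitness n) a b c =
      (if b = c then X a b else 0) + (if c = b + 1 then X a b else 0) +
        (if c = b then X a (b + 1) else 0) := by
  rw [actTensor_fst_apply]
  simp only [bandWitness, mul_add, Finset.sum_add_distrib]
  have h1 : ∑ a', X a a' * (if a' = b ∧ b = c then (1 : ℂ) else 0) = if b = c then X a b else 0 := by
    rw [Finset.sum_eq_single b]
    · by_cases h : b = c <;> simp [h]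
    · intro k _ hk; simp [hk]
    · intro h; exact absurd (Finset.mem_univ b) h
  have h2 : ∑ a', X a a' * (if a' = b ∧ c = b + 1 then (1 : ℂ) else 0) =
      if c = b + 1 then X a b else 0 := by
    rw [Finset.sum_eq_single b]
    · by_cases h : c = b + 1 <;> simp [h]
    · intro k _ hk; simp [hk]
    · intro h; exact absurd (Finset.mem_univ b) h
  have h3 : ∑ a', X a a' * (if a' = b + 1 ∧ c = b then (1 : ℂ) else 0) =
      if c = b then X a (b + 1) else 0 := by
    rw [Finset.sum_eq_single (b + 1)]
    · by_cases h : c = b <;> simp [h]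
    · intro k _ hk; simp [hk]
    · intro h; exact absurd (Finset.mem_univ (b + 1)) h
  rw [h1, h2, h3]

/-- `(1 ⊗ Y ⊗ 1)·w_m` in coordinates. [folklore] -/
private theorem actTensor_snd_bandWitness (Y : Matrix (Fin (n + 4)) (Fin (n + 4)) ℂ)
    (a b c : Fin (n + 4)) :
    actTensor (1 : Matrix (Fin (n + 4)) (Fin (n + 4)) ℂ) Y (1 : Matrix (Fin (n + 4)) (Fin (n + 4)) ℂ)
        (bandWitness n) a b c =
      (if a = c then Y b a else 0) + (if c = a + 1 then Y b a else 0) +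
        (if a = c + 1 then Y b c else 0) := by
  rw [actTensor_snd_apply]
  simp only [bandWitness, mul_add, Finset.sum_add_distrib]
  have h1 : ∑ b', Y b b' * (if a = b' ∧ b' = c then (1 : ℂ) else 0) = if a = c then Y b a else 0 := by
    rw [Finset.sum_eq_single a]
    · by_cases h : a = c <;> simp [h]
    · intro k _ hk; simp [Ne.symm hk]
    · intro h; exact absurd (Finset.mem_univ a) h
  have h2 : ∑ b', Y b b' * (if a = b' ∧ c = b' + 1 then (1 : ℂ) else 0) =
      if c = a + 1 then Y b a else 0 := by
    rw [Finset.sum_eq_single a]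
    · by_cases h : c = a + 1 <;> simp [h]
    · intro k _ hk; simp [Ne.symm hk]
    · intro h; exact absurd (Finset.mem_univ a) h
  have h3 : ∑ b', Y b b' * (if a = b' + 1 ∧ c = b' then (1 : ℂ) else 0) =
      if a = c + 1 then Y b c else 0 := by
    rw [Finset.sum_eq_single c]
    · by_cases h : a = c + 1 <;> simp [h]
    · intro k _ hk; simp [Ne.symm hk]
    · intro h; exact absurd (Finset.mem_univ c) h
  rw [h1, h2, h3]

/-- `(1 ⊗ 1 ⊗ Z)·w_m` in coordinates. [folklore] -/
private theorem actTensor_thd_bandWitness (Z : Matrix (Fin (n + 4)) (Fin (n + 4)) ℂ)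
    (a b c : Fin (n + 4)) :
    actTensor (1 : Matrix (Fin (n + 4)) (Fin (n + 4)) ℂ) (1 : Matrix (Fin (n + 4)) (Fin (n + 4)) ℂ) Z
        (bandWitness n) a b c =
      (if a = b then Z c b else 0) + (if a = b then Z c (b + 1) else 0) +
        (if a = b + 1 then Z c b else 0) := by
  rw [actTensor_thd_apply]
  simp only [bandWitness, mul_add, Finset.sum_add_distrib]
  have h1 : ∑ c', Z c c' * (if a = b ∧ b = c' then (1 : ℂ) else 0) = if a = b then Z c b else 0 := by
    rw [Finset.sum_eq_single b]
    · by_cases h : a = b <;> simp [h]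
    · intro k _ hk; simp [Ne.symm hk]
    · intro h; exact absurd (Finset.mem_univ b) h
  have h2 : ∑ c', Z c c' * (if a = b ∧ c' = b + 1 then (1 : ℂ) else 0) =
      if a = b then Z c (b + 1) else 0 := by
    rw [Finset.sum_eq_single (b + 1)]
    · by_cases h : a = b <;> simp [h]
    · intro k _ hk; simp [hk]
    · intro h; exact absurd (Finset.mem_univ (b + 1)) h
  have h3 : ∑ c', Z c c' * (if a = b + 1 ∧ c' = b then (1 : ℂ) else 0) =
      if a = b + 1 then Z c b else 0 := by
    rw [Finset.sum_eq_single b]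
    · by_cases h : a = b + 1 <;> simp [h]
    · intro k _ hk; simp [hk]
    · intro h; exact absurd (Finset.mem_univ b) h
  rw [h1, h2, h3]

/-- **The infinitesimal action on `w_m`, in coordinates** — the nine-term formula
`((X ⊗ 1 ⊗ 1 + 1 ⊗ Y ⊗ 1 + 1 ⊗ 1 ⊗ Z)·w_m)_{abc} = [b=c] X_{ab} + [c=b+1] X_{ab} + [c=b] X_{a,b+1}
 + [a=c] Y_{ba} + [c=a+1] Y_{ba} + [a=c+1] Y_{bc} + [a=b] Z_{cb} + [a=b] Z_{c,b+1} + [a=b+1] Z_{cb}`.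
[cite: BurgisserIkenmeyer2017, §4.1 eq. (4.1) (infinitesimal form)] -/
theorem lieAction_bandWitness_apply (X Y Z : Matrix (Fin (n + 4)) (Fin (n + 4)) ℂ)
    (a b c : Fin (n + 4)) :
    (actTensor X (1 : Matrix (Fin (n + 4)) (Fin (n + 4)) ℂ) (1 : Matrix (Fin (n + 4)) (Fin (n + 4)) ℂ)
          (bandWitness n) +
        actTensor (1 : Matrix (Fin (n + 4)) (Fin (n + 4)) ℂ) Y (1 : Matrix (Fin (n + 4)) (Fin (n + 4)) ℂ)
          (bandWitness n) +
        actTensor (1 : Matrix (Fin (n + 4)) (Fin (n + 4)) ℂ) (1 : Matrix (Fin (n + 4)) (Fin (n + 4)) ℂ) Z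
          (bandWitness n)) a b c =
      (if b = c then X a b else 0) + (if c = b + 1 then X a b else 0) +
          (if c = b then X a (b + 1) else 0) +
        ((if a = c then Y b a else 0) + (if c = a + 1 then Y b a else 0) +
          (if a = c + 1 then Y b c else 0)) +
        ((if a = b then Z c b else 0) + (if a = b then Z c (b + 1) else 0) +
          (if a = b + 1 then Z c b else 0)) := by
  simp only [Pi.add_apply, actTensor_fst_bandWitness, actTensor_snd_bandWitness,
    actTensor_thd_bandWitness]

/-- **The witness `w_m` has zero traceless infinitesimal stabilizer** (`m = n + 4 ≥ 4`): the
elimination described in the module docstring.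
[cite: BurgisserIkenmeyer2017, Thm. 4.2 and Prop. 4.10 (proof)] -/
theorem hasTrivialSL3LieStabilizer_bandWitness : HasTrivialSL3LieStabilizer (bandWitness n) := by
  intro X Y Z hX hY hZ hL
  -- the shift `σ b = b + 1` and its elementary properties (`1, 2, 3 ≠ 0` in `ℤ/(n+4)`)
  let σ : Fin (n + 4) → Fin (n + 4) := fun b => b + 1
  have hv1 : ((1 : Fin (n + 4)) : ℕ) = 1 := Fin.val_one _
  have hv2 : (((1 : Fin (n + 4)) + 1 : Fin (n + 4)) : ℕ) = 2 := by
    rw [Fin.val_add, hv1, Nat.mod_eq_of_lt (by omega)]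
  have hv3 : (((1 : Fin (n + 4)) + 1 + 1 : Fin (n + 4)) : ℕ) = 3 := by
    rw [Fin.val_add, hv2, hv1, Nat.mod_eq_of_lt (by omega)]
  have h1 : (1 : Fin (n + 4)) ≠ 0 := fun h => by
    have := congrArg Fin.val h; rw [hv1, Fin.val_zero] at this; omega
  have h2 : (1 : Fin (n + 4)) + 1 ≠ 0 := fun h => by
    have := congrArg Fin.val h; rw [hv2, Fin.val_zero] at this; omega
  have h3 : (1 : Fin (n + 4)) + 1 + 1 ≠ 0 := fun h => by
    have := congrArg Fin.val h; rw [hv3, Fin.val_zero] at this; omega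
  have σinj : ∀ x y : Fin (n + 4), σ x = σ y ↔ x = y := fun x y => add_left_inj 1
  have σ1 : ∀ x : Fin (n + 4), σ x ≠ x := fun x h => h1 (by
    have : x + 1 = x + 0 := by rw [add_zero]; exact h
    exact add_left_cancel this)
  have σ2 : ∀ x : Fin (n + 4), σ (σ x) ≠ x := fun x h => h2 (by
    have : x + (1 + 1) = x + 0 := by rw [add_zero, ← add_assoc]; exact h
    exact add_left_cancel this)
  have σ3 : ∀ x : Fin (n + 4), σ (σ (σ x)) ≠ x := fun x h => h3 (by
    have : x + (1 + 1 + 1) = x + 0 := by rw [add_zero, ← add_assoc, ← add_assoc]; exact h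
    exact add_left_cancel this)
  have σ1' : ∀ x : Fin (n + 4), x ≠ σ x := fun x h => σ1 x h.symm
  have σ2' : ∀ x : Fin (n + 4), x ≠ σ (σ x) := fun x h => σ2 x h.symm
  have σ3' : ∀ x : Fin (n + 4), x ≠ σ (σ (σ x)) := fun x h => σ3 x h.symm
  -- the nine-term equations, in `σ`-form
  have E : ∀ a b c : Fin (n + 4),
      (if b = c then X a b else 0) + (if c = σ b then X a b else 0) +
          (if c = b then X a (σ b) else 0) +
        ((if a = c then Y b a else 0) + (if c = σ a then Y b a else 0) +
          (if a = σ c then Y b c else 0)) +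
        ((if a = b then Z c b else 0) + (if a = b then Z c (σ b) else 0) +
          (if a = σ b then Z c b else 0)) = 0 := by
    intro a b c
    have h := congr_fun (congr_fun (congr_fun hL a) b) c
    rw [lieAction_bandWitness_apply] at h
    exact h
  -- Step 1: the three bands
  have bX : ∀ a b, a ≠ b → a ≠ σ b → a ≠ σ (σ b) → X a b = 0 := by
    intro a b hab hab1 hab2
    have e := E a b (σ b)
    simp only [σinj, σ1, σ1', if_false, if_true, zero_add, add_zero, hab, Ne.symm hab, hab1,
      hab2] at e
    exact e
  have bY : ∀ b a, b ≠ a → b ≠ σ a → a ≠ σ b → Y b a = 0 := by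
    intro b a hba hba1 hab1
    have e := E a b (σ a)
    simp only [σinj, σ1', σ2', if_false, if_true, zero_add, add_zero, Ne.symm hba, hba1,
      Ne.symm hba1, hab1] at e
    exact e
  have bZ : ∀ c b, c ≠ b → c ≠ σ b → c ≠ σ (σ b) → Z c b = 0 := by
    intro c b hcb hcb1 hcb2
    have e := E (σ b) b c
    simp only [σinj, σ1, if_false, if_true, zero_add, add_zero, hcb, Ne.symm hcb, hcb1,
      Ne.symm hcb1, hcb2] at e
    exact e
  -- handy out-of-band entries
  have X03 : ∀ b, X (σ (σ (σ b))) b = 0 := fun b =>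
    bX _ _ (σ3 b) (by rw [Ne, σinj]; exact σ2 b) (by rw [Ne, σinj, σinj]; exact σ1 b)
  have X01 : ∀ b, X b (σ b) = 0 := fun b =>
    bX _ _ (σ1' b) (σ2' b) (σ3' b)
  have Z03 : ∀ b, Z (σ (σ (σ b))) b = 0 := fun b =>
    bZ _ _ (σ3 b) (by rw [Ne, σinj]; exact σ2 b) (by rw [Ne, σinj, σinj]; exact σ1 b)
  have Z01 : ∀ b, Z b (σ b) = 0 := fun b =>
    bZ _ _ (σ1' b) (σ2' b) (σ3' b)
  -- Step 2: `Y_{b+1,b} = 0` from the pattern `(b, b+1, b)`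
  have Y10 : ∀ b, Y (σ b) b = 0 := by
    intro b
    have e := E b (σ b) b
    simp only [σ1, σ1', σ2', if_false, if_true, zero_add, add_zero] at e
    exact e
  -- Step 3: `Z_{b+3,b+1} = 0` from `(b, b, b+3)` and `X_{b+3,b+1} = 0` from `(b+3, b, b)`
  have Z2 : ∀ b, Z (σ (σ b)) b = 0 := by
    intro b'
    -- apply the pattern at `b` with `σ b = b'`? use `(b, b, σ σ σ b)` for all `b`, then reindex
    have key : ∀ b, Z (σ (σ (σ b))) (σ b) = 0 := by
      intro b
      have e := E b b (σ (σ (σ b)))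
      have hY : (if b = σ (σ (σ (σ b))) then Y b (σ (σ (σ b))) else 0) = 0 := by
        split_ifs with h
        · have : Y (σ (σ (σ (σ b)))) (σ (σ (σ b))) = 0 := Y10 _
          rwa [← h] at this
        · rfl
      simp only [σinj, σ1', σ2, σ3, σ3', if_false, if_true, zero_add, add_zero, hY, Z03] at e
      exact e
    -- every `b'` is `σ b` for `b = b' - 1`
    have := key (b' - 1)
    have e1 : σ (b' - 1) = b' := sub_add_cancel b' 1
    rw [e1] at this
    exact this
  have X2 : ∀ b, X (σ (σ b)) b = 0 := by
    intro b'
    have key : ∀ b, X (σ (σ (σ b))) (σ b) = 0 := by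
      intro b
      have e := E (σ (σ (σ b))) b b
      have hY : (if b = σ (σ (σ (σ b))) then Y b (σ (σ (σ b))) else 0) = 0 := by
        split_ifs with h
        · have : Y (σ (σ (σ (σ b)))) (σ (σ (σ b))) = 0 := Y10 _
          rwa [← h] at this
        · rfl
      simp only [σinj, σ1', σ2, σ3, if_false, if_true, zero_add, add_zero, hY, X03] at e
      exact e
    have := key (b' - 1)
    have e1 : σ (b' - 1) = b' := sub_add_cancel b' 1
    rw [e1] at this
    exact this
  -- Step 4: `Y_{b,b+1} = 0` from `(b+2, b, b+1)`; then `X_{b+1,b} = 0`, `Z_{b+1,b} = 0`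
  have Y01 : ∀ b, Y b (σ b) = 0 := by
    intro b
    have e := E (σ (σ b)) b (σ b)
    simp only [σinj, σ1, σ1', σ2, σ2', if_false, if_true, zero_add, add_zero, X2] at e
    exact e
  have X1 : ∀ b, X (σ b) b = 0 := by
    intro b'
    have key : ∀ b, X (σ (σ b)) (σ b) = 0 := by
      intro b
      have e := E (σ (σ b)) b b
      simp only [σinj, σ1, σ1', σ2, σ3', if_false, if_true, zero_add, add_zero, X2] at e
      exact e
    have := key (b' - 1)
    have e1 : σ (b' - 1) = b' := sub_add_cancel b' 1
    rw [e1] at this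
    exact this
  have Z1 : ∀ b, Z (σ b) b = 0 := by
    intro b'
    have key : ∀ b, Z (σ (σ b)) (σ b) = 0 := by
      intro b
      have e := E b b (σ (σ b))
      simp only [σinj, σ1, σ1', σ2, σ2', σ3', if_false, if_true, zero_add, add_zero, Z2] at e
      exact e
    have := key (b' - 1)
    have e1 : σ (b' - 1) = b' := sub_add_cancel b' 1
    rw [e1] at this
    exact this
  -- Step 5: the diagonals are constant
  have dZ : ∀ b, Z (σ b) (σ b) = Z b b := by
    intro b
    have e0 := E b b b
    have e1 := E b b (σ b)
    simp only [σ1, σ1', σ2', if_false, if_true, zero_add, add_zero, X01, Z01, Z1] at e0 e1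
    -- e0 : X b b + Y b b + Z b b = 0 ; e1 : X b b + Y b b + Z (σ b) (σ b) = 0
    linear_combination e1 - e0
  have dX : ∀ b, X (σ b) (σ b) = X b b := by
    intro b
    have e0 := E b b b
    have e1 := E (σ b) b b
    simp only [σ1, σ1', σ2', if_false, if_true, zero_add, add_zero, X01, Z01, X1] at e0 e1
    linear_combination e1 - e0
  have dY : ∀ b, Y b b = -(X b b + Z b b) := by
    intro b
    have e0 := E b b b
    simp only [σ1', if_false, if_true, add_zero, X01, Z01] at e0
    linear_combination e0
  -- Step 6: traces kill the constants
  have cX : ∀ b, X b b = X 0 0 := by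
    intro b
    induction b using Fin.induction with
    | zero => rfl
    | succ i ih => rw [← Fin.coeSucc_eq_succ]; exact (dX _).trans ih
  have cZ : ∀ b, Z b b = Z 0 0 := by
    intro b
    induction b using Fin.induction with
    | zero => rfl
    | succ i ih => rw [← Fin.coeSucc_eq_succ]; exact (dZ _).trans ih
  have hcard : ((n + 4 : ℕ) : ℂ) ≠ 0 := Nat.cast_ne_zero.mpr (by omega)
  have X00 : X 0 0 = 0 := by
    have h := hX
    rw [Matrix.trace] at h
    change ∑ i : Fin (n + 4), X i i = 0 at h
    rw [Finset.sum_congr rfl fun i (_ : i ∈ Finset.univ) => cX i, Finset.sum_const,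
      Finset.card_univ, Fintype.card_fin, nsmul_eq_mul] at h
    exact (mul_eq_zero.mp h).resolve_left hcard
  have Z00 : Z 0 0 = 0 := by
    have h := hZ
    rw [Matrix.trace] at h
    change ∑ i : Fin (n + 4), Z i i = 0 at h
    rw [Finset.sum_congr rfl fun i (_ : i ∈ Finset.univ) => cZ i, Finset.sum_const,
      Finset.card_univ, Fintype.card_fin, nsmul_eq_mul] at h
    exact (mul_eq_zero.mp h).resolve_left hcard
  have X0 : ∀ b, X b b = 0 := fun b => (cX b).trans X00
  have Z0 : ∀ b, Z b b = 0 := fun b => (cZ b).trans Z00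
  have Y0 : ∀ b, Y b b = 0 := fun b => by rw [dY, X0, Z0, add_zero, neg_zero]
  -- assembly
  refine ⟨?_, ?_, ?_⟩
  · ext a b
    rw [Matrix.zero_apply]
    by_cases h0 : a = b
    · rw [h0]; exact X0 b
    by_cases h1' : a = σ b
    · rw [h1']; exact X1 b
    by_cases h2' : a = σ (σ b)
    · rw [h2']; exact X2 b
    exact bX a b h0 h1' h2'
  · ext b a
    rw [Matrix.zero_apply]
    by_cases h0 : b = a
    · rw [h0]; exact Y0 a
    by_cases h1' : b = σ a
    · rw [h1']; exact Y10 a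
    by_cases h2' : a = σ b
    · rw [h2']; exact Y01 b
    exact bY b a h0 h1' h2'
  · ext c b
    rw [Matrix.zero_apply]
    by_cases h0 : c = b
    · rw [h0]; exact Z0 b
    by_cases h1' : c = σ b
    · rw [h1']; exact Z1 b
    by_cases h2' : c = σ (σ b)
    · rw [h2']; exact Z2 b
    exact bZ c b h0 h1' h2'

end Witness

/-! ### Generic finiteness for every `m ≥ 3`, and Prop. 4.10 from Popov 1970 alone -/

section Generic

/-- **For every `m ≥ 3`, almost all `w ∈ ⊗³ℂ^m` have a finite `SL_m × SL_m × SL_m`-stabilizer**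
(the generic finiteness of `stab'(w)` fed into Popov's criterion in the printed proof of BI 2017
Prop. 4.10): `m = 3` by the kernel certificate `isZariskiGenericTensor_finite_slStabilizer_three`,
`m ≥ 4` by the witness `bandWitness` and the Lie-algebra criterion.
[cite: BurgisserIkenmeyer2017, Thm. 4.2 and Prop. 4.10 (proof)] -/
theorem isZariskiGenericTensor_finite_slStabilizer {m : ℕ} (hm : 3 ≤ m) :
    IsZariskiGenericTensor fun w : Fin m → Fin m → Fin m → ℂ =>
      {g : Matrix.SpecialLinearGroup (Fin m) ℂ × Matrix.SpecialLinearGroup (Fin m) ℂ ×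
          Matrix.SpecialLinearGroup (Fin m) ℂ |
        actTensor (g.1 : Matrix (Fin m) (Fin m) ℂ) (g.2.1 : Matrix (Fin m) (Fin m) ℂ)
          (g.2.2 : Matrix (Fin m) (Fin m) ℂ) w = w}.Finite := by
  obtain rfl | hm4 : m = 3 ∨ 4 ≤ m := by omega
  · exact isZariskiGenericTensor_finite_slStabilizer_three
  · obtain ⟨n, rfl⟩ : ∃ n, m = n + 4 := ⟨m - 4, by omega⟩
    exact isZariskiGenericTensor_finite_slStabilizer_of_exists _
      (hasTrivialSL3LieStabilizer_bandWitness n)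

/-- **BI 2017, Prop. 4.10 from Popov's 1970 stability criterion ALONE, BY NAME** ("Almost all
`w ∈ ⊗³ℂ^m` are polystable"): the criterion `Popov1970_genericClosedOrbit_tensor` (cite-fact) fed
with the THEOREM `isZariskiGenericTensor_finite_slStabilizer` (`m ≥ 3`); `m ≤ 1` trivial
(`isZariskiGenericTensor_isPolystableTensor_of_le_one`), `m = 2` the tree's `BI2017_prop_4_10_two`.
An edge, not a discharge: `BI2017_prop_4_10 ⇐ {Popov1970_genericClosedOrbit_tensor}`.
[cite: BurgisserIkenmeyer2017, Prop. 4.10] -/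
theorem BI2017_prop_4_10_of_popov70 (h70 : Popov1970_genericClosedOrbit_tensor) :
    BI2017_prop_4_10 := by
  intro m
  obtain hm | rfl | hm : m ≤ 1 ∨ m = 2 ∨ 3 ≤ m := by omega
  · exact isZariskiGenericTensor_isPolystableTensor_of_le_one hm
  · exact BI2017_prop_4_10_two
  · exact h70 m (by omega) (isZariskiGenericTensor_finite_slStabilizer hm)

/-- **BI 2017, Cor. 5.12 from `BI2017_thm_4_2` and Popov's 1970 criterion, BY NAME**: through
`BI2017_cor_5_12_of_thm_4_2_of_prop_4_10` with Prop. 4.10 supplied by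
`BI2017_prop_4_10_of_popov70`. An edge, not a discharge:
`BI2017_cor_5_12 ⇐ {BI2017_thm_4_2, Popov1970_genericClosedOrbit_tensor}`.
[cite: BurgisserIkenmeyer2017, Cor. 5.12] -/
theorem BI2017_cor_5_12_of_thm_4_2_of_popov70 (h42 : BI2017_thm_4_2)
    (h70 : Popov1970_genericClosedOrbit_tensor) : BI2017_cor_5_12 :=
  BI2017_cor_5_12_of_thm_4_2_of_prop_4_10 h42 (BI2017_prop_4_10_of_popov70 h70)

end Generic

end Literature.Computability.AlgebraicComplexity

end
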